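/-
K-task «TOWER» (cell rh-split, lead RULING #329; spec rh-idea-5 g2 `TOWER-BARRIER.md` §5 + §1, sha16 b241d1db4bf38dc5;
barrier candidate B26 «TOWER BARRIER», B16-bis).  Model file: proof = the tree's
`ScrewLatticeWolffOneCircle.exists_blind_model_discrete` argument run on `ScrewLatticeTower.exists_towerData`.
Nothing here bears on the truth of RH.
-/
import Summits.RiemannHypothesis.RiemannHypothesis.Theorems.Splittings.ScrewLatticeWolffModel
import Summits.RiemannHypothesis.RiemannHypothesis.Theorems.Splittings.ScrewLatticeTowerC
import Mathlib.Analysis.SpecialFunctions.Complex.Arg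
import Mathlib.Analysis.SpecialFunctions.Log.Basic
import HarnessLib

/-!
# The rigid polygon TOWER as a blind model for the lattice screw criteria (B16-bis)

Fed to B16's model machinery (`ScrewLatticeWolff`, `ScrewLatticeWolffModel`: abscissae `Re κ = log ‖w‖ / h`,
aliased ordinates, tuned positive weights), the tower data of `ScrewLatticeTowerC.exists_towerData` give a
BLIND positive-real-weight configuration — uniform floor, ceiling and `LPSD(h)` on the lattice `hℕ` — whose
abscissae are discrete below `σ*` (one-circle wall), exactly as the divisor rings of B16′
(`ScrewLatticeWolffOneCircle.exists_blind_model_discrete`).  What is NEW is the INPUT (memo §1/§4 (γ)): the tower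
is not a packing; its masses are the exact residual-absorbing vertex masses `|x_n|/(n r_nⁿ)` on regular gons at
radii `1 - 1/(c n)` — the configuration whose weight-count exponent `w = c·ln 2/(1 + c·ln 2)` the memo computes
(§1 (v); the exponent and the rigid class of §2 are NOT formalised here).  Depth range of this kernel:
`e^{-1/c} ≤ 1/18` (e.g. `c ≤ 1/3`, `ScrewLatticeTower.exp_neg_inv_le`).  ζ-free, RH-free; std axioms.
Nothing here bears on the truth of RH.
-/

noncomputable section

set_option linter.dupNamespace false

open Complex Set Filter Topology
open scoped ComplexConjugate Real

namespace Summit.RiemannHypothesis.RiemannHypothesis.Theorems.Splittings.ScrewLatticeTower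

open Summit.RiemannHypothesis.RiemannHypothesis.Theorems.Splittings.ScrewLatticeWolff
open Summit.RiemannHypothesis.RiemannHypothesis.Theorems.Splittings.ScrewLatticeWolffModel

/-- **B16-bis, kernel form (rigid polygon TOWER; memo §5 with FREE positive weights).**  For every `h > 0`,
`σ* > 0` and every depth `c > 0` with `e^{-1/c} ≤ 1/18` there is a positive-real-weight configuration of zero
quadruples with abscissae in `(0, σ*)`, ordinates `> 14` and locally finite, `Σ m/γ² < ∞`, whose model screw
supremum of abscissae is NOT attained, whose model screw function has a uniform positive floor, is bounded, and is
positive semidefinite (`LPSD(h)`) on the lattice `hℕ` — exactly the clause list of B16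
(`ScrewLatticeWolffModel.exists_blind_model`) — and whose abscissae are DISCRETE BELOW `σ*`
(for every `σ < σ*` only finitely many `i` have `Re κ₁ i ≤ σ`; the aliased wall is the single circle
`‖s‖ = e^{-σ* h}`), built NOT on a disc packing but on the rigid polygon TOWER of `ScrewLatticeTowerA–C` (memo
§1: regular gons at radii `1 - 1/(c n)`, rotations `0`/`π/n`, equal positive vertex masses absorbing the residual
moments in increasing order).  HONEST LABEL: a blind model is an obstruction statement about the lattice screw
criteria, RH-free; nothing here bears on the truth of RH. -/
theorem exists_tower_blind_model {h σs c : ℝ} (hh : 0 < h) (hσs : 0 < σs) (hc : 0 < c)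
    (hx : Real.exp (-(1 / c)) ≤ 1 / 18) :
    ∃ (ι : Type) (m₁ m₂ : ι → ℝ) (κ₁ κ₂ : ι → ℂ),
      Nonempty ι ∧
      (∀ i, 0 < m₁ i ∧ 0 < m₂ i) ∧
      (∀ i, 0 < (κ₁ i).re ∧ (κ₁ i).re < σs ∧ (κ₂ i).re = (κ₁ i).re) ∧
      (∀ i, 14 < (κ₁ i).im ∧ 14 < (κ₂ i).im) ∧
      (∀ T : ℝ, {i | (κ₁ i).im ≤ T}.Finite ∧ {i | (κ₂ i).im ≤ T}.Finite) ∧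
      Summable (fun i ↦ m₁ i / (κ₁ i).im ^ 2 + m₂ i / (κ₂ i).im ^ 2) ∧
      (∀ i, ∃ j, (κ₁ i).re < (κ₁ j).re) ∧
      (∃ A : ℝ, 0 < A ∧ ∀ k : ℕ, 1 ≤ k →
          2 * A ≤ modelPsi m₁ m₂ κ₁ κ₂ (k * h) ∧ modelPsi m₁ m₂ κ₁ κ₂ (k * h) ≤ 6 * A) ∧
      (∀ (N : ℕ) (t x : Fin N → ℝ), (∀ a, t a ∈ Set.range fun k : ℕ ↦ (k : ℝ) * h) →
          0 ≤ ∑ a, ∑ b, (modelPsi m₁ m₂ κ₁ κ₂ (t a) + modelPsi m₁ m₂ κ₁ κ₂ (t b)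
            - modelPsi m₁ m₂ κ₁ κ₂ (t a - t b)) * (x a * x b)) ∧
      (∀ σ < σs, {i | (κ₁ i).re ≤ σ}.Finite) := by
  have hh0 : h ≠ 0 := hh.ne'
  -- tower data in the annulus `1 < |w| < e^{σ* h}`
  have hR : 1 < Real.exp (σs * h) := Real.one_lt_exp_iff.mpr (by positivity)
  obtain ⟨ι, hcount, w, α, hne, hann, hα0, hαs, hW, hsup, hdisc⟩ := exists_towerData hR hc hx
  haveI : Countable ι := hcount
  obtain ⟨f, hf⟩ := Countable.exists_injective_nat ι
  -- aliases
  set N₀ : ℕ := ⌈(14 * h + 2 * σs * h + π) / (2 * π)⌉₊ + 1 with hN₀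
  have hN₀ge : (14 * h + 2 * σs * h + π) / (2 * π) + 1 ≤ (N₀ : ℝ) := by
    rw [hN₀]; push_cast; linarith [Nat.le_ceil ((14 * h + 2 * σs * h + π) / (2 * π))]
  set Nf : ι → ℕ := fun i ↦ N₀ + f i with hNf
  -- the data
  set σ : ι → ℝ := fun i ↦ Real.log ‖w i‖ / h with hσ_def
  set γ₁ : ι → ℝ := fun i ↦ (arg (w i) + 2 * π * (Nf i : ℕ)) / h with hγ₁_def
  set γ₂ : ι → ℝ := fun i ↦ (2 * π * (Nf i : ℕ) - arg (w i)) / h with hγ₂_def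
  set κ₁ : ι → ℂ := fun i ↦ ((σ i : ℝ) : ℂ) + ((γ₁ i : ℝ) : ℂ) * I with hκ₁_def
  set κ₂ : ι → ℂ := fun i ↦ ((σ i : ℝ) : ℂ) + ((γ₂ i : ℝ) : ℂ) * I with hκ₂_def
  -- elementary facts
  have hw0 : ∀ i, w i ≠ 0 := fun i ↦ by
    intro h0; have := (hann i).1; rw [h0, norm_zero] at this; linarith
  have hσpos : ∀ i, 0 < σ i := fun i ↦ div_pos (Real.log_pos (hann i).1) hh
  have hσlt : ∀ i, σ i < σs := fun i ↦ by
    rw [hσ_def]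
    simp only
    rw [div_lt_iff₀ hh]
    exact (Real.log_lt_iff_lt_exp (norm_pos_iff.mpr (hw0 i))).mpr (hann i).2
  have hNlow : ∀ i, 14 * h + 2 * σs * h + π ≤ 2 * π * (Nf i : ℕ) - 2 * π := by
    intro i
    have h1 : (N₀ : ℝ) ≤ (Nf i : ℕ) := by rw [hNf]; push_cast; linarith [(f i).cast_nonneg (α := ℝ)]
    have h2 : (14 * h + 2 * σs * h + π) / (2 * π) ≤ (Nf i : ℕ) - 1 := by linarith
    rw [div_le_iff₀ (by positivity)] at h2
    linarith
  have hγ₁low : ∀ i, 14 + 2 * σs < γ₁ i := by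
    intro i
    rw [hγ₁_def]; simp only; rw [lt_div_iff₀ hh]
    linarith [hNlow i, Complex.neg_pi_lt_arg (w i), Real.pi_pos]
  have hγ₂low : ∀ i, 14 + 2 * σs < γ₂ i := by
    intro i
    rw [hγ₂_def]; simp only; rw [lt_div_iff₀ hh]
    linarith [hNlow i, Complex.arg_le_pi (w i), Real.pi_pos]
  -- tuning (λ = 1, c = α i)
  have htun : ∀ i, ∃ m₁ m₂ : ℝ, 0 < m₁ ∧ 0 < m₂ ∧
      (m₁ : ℂ) / ((σ i : ℂ) + γ₁ i * I) ^ 2 + (m₂ : ℂ) / (conj ((σ i : ℂ) + γ₂ i * I)) ^ 2 = -(α i : ℂ) ∧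
      m₁ / γ₁ i ^ 2 ≤ 3 * α i ∧ m₂ / γ₂ i ^ 2 ≤ 3 * α i := fun i ↦
    exists_tuning_bound (hσpos i) (by linarith [hσlt i, hγ₁low i]) (by linarith [hσlt i, hγ₂low i])
      (hα0 i)
  choose m₁ m₂ hm₁ hm₂ htune hb₁ hb₂ using htun
  -- hypotheses of the model theorems
  have hw₁ : ∀ i, Complex.exp (κ₁ i * h) = w i := fun i ↦ exp_kappa₁ (hw0 i) hh0 (Nf i)
  have hw₂ : ∀ i, Complex.exp (κ₂ i * h) = conj (w i) := fun i ↦ exp_kappa₂ (hw0 i) hh0 (Nf i)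
  have htune' : ∀ i, (m₁ i : ℂ) / κ₁ i ^ 2 + (m₂ i : ℂ) / (conj (κ₂ i)) ^ 2
      = -(((1 : ℝ) * α i : ℝ) : ℂ) := by
    intro i; rw [one_mul]; exact htune i
  have hα0' : ∀ i, 0 ≤ α i := fun i ↦ (hα0 i).le
  have hw1 : ∀ i, 1 ≤ ‖w i‖ := fun i ↦ (hann i).1.le
  refine ⟨ι, m₁, m₂, κ₁, κ₂, hne, fun i ↦ ⟨hm₁ i, hm₂ i⟩, ?_, ?_, ?_, ?_, ?_, ?_, ?_, ?_⟩
  · intro i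
    refine ⟨?_, ?_, ?_⟩
    · simpa [hκ₁_def] using hσpos i
    · simpa [hκ₁_def] using hσlt i
    · simp [hκ₁_def, hκ₂_def]
  · intro i
    constructor
    · simpa [hκ₁_def] using (by linarith [hγ₁low i] : 14 < γ₁ i)
    · simpa [hκ₂_def] using (by linarith [hγ₂low i] : 14 < γ₂ i)
  · -- local finiteness: `Im κ ≤ T` forces `f i ≤ ⌊…⌋`, and `f` is injective
    intro T
    have key : ∀ i, (2 * π * (Nf i : ℕ) - π) / h ≤ T → f i ∈ Iic ⌈(T * h + π) / (2 * π)⌉₊ := by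
      intro i hi
      rw [mem_Iic]
      rw [div_le_iff₀ hh] at hi
      have h1 : (f i : ℝ) ≤ (Nf i : ℕ) := by rw [hNf]; push_cast; linarith [(N₀).cast_nonneg (α := ℝ)]
      have h2 : (Nf i : ℝ) ≤ (T * h + π) / (2 * π) := by
        rw [le_div_iff₀ (by positivity)]; linarith
      exact_mod_cast (h1.trans h2).trans (Nat.le_ceil _)
    have hfin : (f ⁻¹' Iic ⌈(T * h + π) / (2 * π)⌉₊).Finite :=
      (finite_Iic _).preimage hf.injOn
    constructor
    · refine hfin.subset fun i hi ↦ key i ?_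
      have hi' : γ₁ i ≤ T := by simpa [hκ₁_def] using hi
      refine le_trans ?_ hi'
      rw [hγ₁_def]; simp only
      exact div_le_div_of_nonneg_right (by linarith [Complex.neg_pi_lt_arg (w i)]) hh.le
    · refine hfin.subset fun i hi ↦ key i ?_
      have hi' : γ₂ i ≤ T := by simpa [hκ₂_def] using hi
      refine le_trans ?_ hi'
      rw [hγ₂_def]; simp only
      exact div_le_div_of_nonneg_right (by linarith [Complex.arg_le_pi (w i)]) hh.le
  · -- Σ m/γ² ≤ 6 Σ α
    have hs6 : Summable (fun i ↦ 6 * α i) := hαs.mul_left 6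
    refine Summable.of_nonneg_of_le (fun i ↦ ?_) (fun i ↦ ?_) hs6
    · have := hm₁ i; have := hm₂ i
      simp only [hκ₁_def, hκ₂_def, Complex.add_im, Complex.ofReal_im, Complex.mul_im, Complex.ofReal_re,
        Complex.I_im, Complex.I_re, mul_one, mul_zero, zero_add, add_zero]
      positivity
    · simp only [hκ₁_def, hκ₂_def, Complex.add_im, Complex.ofReal_im, Complex.mul_im, Complex.ofReal_re,
        Complex.I_im, Complex.I_re, mul_one, mul_zero, zero_add, add_zero]
      linarith [hb₁ i, hb₂ i]
  · -- sup not attained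
    intro i
    obtain ⟨j, hlt⟩ := hsup i
    refine ⟨j, ?_⟩
    simp only [hκ₁_def, Complex.add_re, Complex.ofReal_re, Complex.mul_re, Complex.I_re, Complex.I_im,
      Complex.ofReal_im, mul_zero, mul_one, sub_zero, add_zero, hσ_def]
    exact div_lt_div_of_pos_right (Real.log_lt_log (norm_pos_iff.mpr (hw0 i)) hlt) hh
  · -- floor and ceiling with A = Σ α > 0
    refine ⟨∑' i, α i, ?_, fun k hk ↦ ⟨?_, ?_⟩⟩
    · obtain ⟨i₀⟩ := hne
      exact hαs.tsum_pos hα0' i₀ (hα0 i₀)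
    · have := modelPsi_lattice_floor hw₁ hw₂ htune' hαs hα0' hw1 zero_le_one hW hk
      simpa using this
    · have := modelPsi_lattice_ceiling hw₁ hw₂ htune' hαs hα0' hw1 zero_le_one hW hk
      simpa using this
  · intro N t' x ht'
    exact modelPsi_latticePSD hw₁ hw₂ htune' hαs hα0' hw1 zero_le_one hW t' x ht'
  · -- NEW: discreteness of the abscissae below `σ*` (the data are discrete inside the annulus)
    intro σ' hσ'
    have hρ : Real.exp (σ' * h) < Real.exp (σs * h) := Real.exp_lt_exp.mpr (by nlinarith)
    refine (hdisc (Real.exp (σ' * h)) hρ).subset fun i hi ↦ ?_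
    simp only [Set.mem_setOf_eq] at hi ⊢
    have hi' : Real.log ‖w i‖ / h ≤ σ' := by
      simpa only [hκ₁_def, Complex.add_re, Complex.ofReal_re, Complex.mul_re, Complex.I_re, Complex.I_im,
        Complex.ofReal_im, mul_zero, mul_one, sub_zero, add_zero, hσ_def] using hi
    rw [div_le_iff₀ hh] at hi'
    exact (Real.log_le_iff_le_exp (norm_pos_iff.mpr (hw0 i))).mp hi'

end Summit.RiemannHypothesis.RiemannHypothesis.Theorems.Splittings.ScrewLatticeTower

end
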